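import Literature.Analysis.FluidPDE.CheskidovShvydkoyNonlinear
import Mathlib.Analysis.InnerProductSpace.PiL2
import Mathlib.Algebra.Order.Chebyshev
import HarnessLib

/-!
# The dyadic `H¹` energy and dissipation of a smooth `L²` field

Analysis/FluidPDE support file (serves the discharge of
`Literature.Analysis.FluidPDE.cheskidov_shvydkoy`, ns.S31). Cheskidov–Shvydkoy's proof of Lemma 3.2
(arXiv:0708.3067, pp. 5–6) runs a Gronwall argument on the weighted block energies
`∑_q λ_q^{2s} ‖u_q‖²₂`; the tree's version uses `s = 1`. This file fixes the bookkeeping of that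
argument for one time slice `v` on `ℝ^ι`, with **proved** comparison lemmas:

* `LPBounds ι`: the Littlewood–Paley toolbox as a hypothesis package (uniform `L² → L²` bound of the
  blocks, Bernstein, reverse Bernstein, `L² → L^∞` Bernstein, convergence of partial block sums, the
  two square-function inequalities) — each field is a theorem of `LittlewoodPaleyFields.lean` /
  `LittlewoodPaleySquareFunction.lean`, packaged so that the a-priori estimate is dimension- and
  constant-agnostic;
* the dyadic quantities `blockL2 v l = ‖Δ̇_l v‖₂`, `blockSup`, `blockGrad v l = ∑_i ‖∂_i Δ̇_l v‖₂`,
  `dyadicF v = ∑_l (2^l ‖Δ̇_l v‖₂)²` (`≈ ‖∇v‖²₂`), `dyadicD v = ∑_l (2^l blockGrad v l)²` (`≈ ‖Δv‖²₂`);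
* the hypotheses of `ParaproductSums.paraproduct_weighted_sum_le` for these sequences:
  `two_zpow_mul_blockL2_le` (reverse Bernstein), `blockL2_le`, `tsum_blockSup_low_le`
  (`∑_{l<J} ‖Δ̇_l v‖_∞ ≤ C_∞ ‖v‖₂ 2^{(J-1)d/2} ∑_n 2^{-nd/2}`);
* the equivalences `dyadicF ≲ ∑_i ‖∂_i v‖²₂ ≲ dyadicF` (`dyadicF_le_gradSq`, `gradSq_le_dyadicF`), the
  bound `dyadicD ≲ ∑ ‖∂∂v‖²₂` (`dyadicD_le_hessSq`), and the uniform tail bound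
  `dyadicD ≤ D_L + 4^{-L}((C_r² C₂ T₃)² + (d C_b C₂ ‖v‖₂)²)` (`dyadicD_le_sum_Icc_add`) that lets the
  truncation level `L → ∞` inside a time integral on a slab with bounded third derivatives.

## References

* A. Cheskidov, R. Shvydkoy, Arch. Ration. Mech. Anal. 195 (2010) 159–169 = arXiv:0708.3067,
  proof of Lemma 3.2, pp. 5–6. [CheskidovShvydkoy2010]
* H. Bahouri, J.-Y. Chemin, R. Danchin, Fourier Analysis and Nonlinear PDE, Springer 2011,
  Lemma 2.1 (Bernstein). [BahouriCheminDanchin2011]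
-/

noncomputable section

open MeasureTheory Filter Topology Function Set
open Literature.Analysis.FunctionSpaces
open scoped ENNReal NNReal RealInnerProductSpace

namespace Literature.Analysis.FluidPDE

variable {ι : Type*} [Fintype ι]

local notation "𝔼" => EuclideanSpace ℝ ι

/-! ## Finite Cauchy–Schwarz in `ℝ≥0∞` -/

omit [Fintype ι] in
/-- `(∑_i x_i)² ≤ |s| ∑_i x_i²` in `ℝ≥0∞`. [folklore] -/
theorem ennreal_sq_sum_le_card_mul_sum_sq {α : Type*} (s : Finset α) (x : α → ℝ≥0∞) :
    (∑ i ∈ s, x i) ^ 2 ≤ s.card * ∑ i ∈ s, x i ^ 2 := by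
  classical
  by_cases h : ∀ i ∈ s, x i ≠ ∞
  · set y : α → ℝ≥0 := fun i => (x i).toNNReal with hy
    have hy' : ∀ i ∈ s, x i = (y i : ℝ≥0∞) := fun i hi => (ENNReal.coe_toNNReal (h i hi)).symm
    have e1 : ∑ i ∈ s, x i = ∑ i ∈ s, (y i : ℝ≥0∞) := Finset.sum_congr rfl hy'
    have e2 : ∑ i ∈ s, x i ^ 2 = ∑ i ∈ s, (y i : ℝ≥0∞) ^ 2 := Finset.sum_congr rfl fun i hi => by rw [hy' i hi]
    rw [e1, e2]
    have key : (∑ i ∈ s, y i) ^ 2 ≤ s.card * ∑ i ∈ s, y i ^ 2 := _root_.sq_sum_le_card_mul_sum_sq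
    exact_mod_cast key
  · push Not at h
    obtain ⟨i, hi, hxi⟩ := h
    refine le_trans le_top (le_of_eq ?_)
    symm
    refine ENNReal.mul_eq_top.2 (Or.inl ⟨?_, ?_⟩)
    · exact_mod_cast (Finset.card_pos.2 ⟨i, hi⟩).ne'
    · refine ENNReal.sum_eq_top.2 ⟨i, hi, ?_⟩
      rw [hxi]; simp

omit [Fintype ι] in
/-- `ofReal (2^j) = 2^j` in `ℝ≥0∞` for `j ∈ ℤ`. [folklore] -/
theorem ofReal_two_zpow (j : ℤ) : ENNReal.ofReal ((2 : ℝ) ^ j) = (2 : ℝ≥0∞) ^ j := by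
  rw [show ((2 : ℝ) ^ j) = (((2 : ℝ≥0) ^ j : ℝ≥0) : ℝ) by simp, ENNReal.ofReal_coe_nnreal,
    ENNReal.coe_zpow two_ne_zero]
  norm_num

/-! ## The Littlewood–Paley constants -/

/-- **The Littlewood–Paley toolbox on `ℝ^ι`, as a hypothesis package.** Uniform constants for: the
`L² → L²` bound of the blocks, Bernstein's inequality for derivatives of blocks, the reverse Bernstein
inequality, the `L² → L^∞` Bernstein inequality, and the convergence of the partial block sums in `L²`,
together with the two square-function inequalities — all **proved** in
`LittlewoodPaleyFields.lean` / `LittlewoodPaleySquareFunction.lean`; packaged here so that the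
a-priori estimate can be stated once for all dimensions and constants. [folklore] -/
structure LPBounds (ι : Type*) [Fintype ι] where
  /-- `‖Δ̇_j f‖₂ ≤ C₂ ‖f‖₂` -/
  C₂ : ℝ≥0
  /-- Bernstein: `‖∂_m Δ̇_j v‖₂ ≤ C_b 2^j ‖m‖ ‖Δ̇_j v‖₂` -/
  Cb : ℝ≥0
  /-- reverse Bernstein: `‖Δ̇_j v‖₂ ≤ C_r 2^{-j} ∑_i ‖∂_i Δ̇_j v‖₂` -/
  Cr : ℝ≥0
  /-- Bernstein `L² → L^∞`: `‖Δ̇_j v‖_∞ ≤ C_∞ 2^{j d/2} ‖v‖₂` -/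
  Cinf : ℝ≥0
  two_le : ∀ (j : ℤ) (f : EuclideanSpace ℝ ι → EuclideanSpace ℝ ι), MemLp f 2 volume →
    eLpNorm (blockFn j f) 2 volume ≤ C₂ * eLpNorm f 2 volume
  bernstein : ∀ (m : EuclideanSpace ℝ ι) (j : ℤ) (v : EuclideanSpace ℝ ι → EuclideanSpace ℝ ι), IsSmoothL2Field v →
    eLpNorm (fun x => fderiv ℝ (blockFn j v) x m) 2 volume ≤
      Cb * ENNReal.ofReal ((2 : ℝ) ^ j * ‖m‖) * eLpNorm (blockFn j v) 2 volume
  reverse : ∀ (j : ℤ) (v : EuclideanSpace ℝ ι → EuclideanSpace ℝ ι), IsSmoothL2Field v →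
    eLpNorm (blockFn j v) 2 volume ≤ Cr * (2 : ℝ≥0∞) ^ (-(j : ℝ)) *
      ∑ i, eLpNorm (fun x => fderiv ℝ (blockFn j v) x (stdOrthonormalBasis ℝ (EuclideanSpace ℝ ι) i)) 2 volume
  sup_le : ∀ (j : ℤ) (v : EuclideanSpace ℝ ι → EuclideanSpace ℝ ι), MemLp v 2 volume →
    eLpNorm (blockFn j v) ∞ volume ≤
      Cinf * (2 : ℝ≥0∞) ^ ((j : ℝ) * Module.finrank ℝ (EuclideanSpace ℝ ι) * 2⁻¹) * eLpNorm v 2 volume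
  tendsto : ∀ (v : EuclideanSpace ℝ ι → EuclideanSpace ℝ ι), MemLp v 2 volume →
    Tendsto (fun N : ℕ => eLpNorm (v - ∑ l ∈ Finset.Icc (-(N : ℤ)) N, blockFn l v) 2 volume) atTop (𝓝 0)
  sq_le : ∀ (v : EuclideanSpace ℝ ι → EuclideanSpace ℝ ι), MemLp v 2 volume →
    ∑' l, eLpNorm (blockFn l v) 2 volume ^ 2 ≤ 8 * eLpNorm v 2 volume ^ 2
  le_sq : ∀ (v : EuclideanSpace ℝ ι → EuclideanSpace ℝ ι), MemLp v 2 volume →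
    eLpNorm v 2 volume ^ 2 ≤ 2 * ∑' l, eLpNorm (blockFn l v) 2 volume ^ 2

/-! ## The dyadic quantities of a field -/

/-- Block `L²` norms `a_l = ‖Δ̇_l v‖₂`. [folklore] -/
def blockL2 (v : 𝔼 → 𝔼) (l : ℤ) : ℝ≥0∞ := eLpNorm (blockFn l v) 2 volume

/-- Block `L^∞` norms `s_l = ‖Δ̇_l v‖_∞`. [folklore] -/
def blockSup (v : 𝔼 → 𝔼) (l : ℤ) : ℝ≥0∞ := eLpNorm (blockFn l v) ∞ volume

/-- Block gradient norms `g_l = ∑_i ‖∂_i Δ̇_l v‖₂`. [folklore] -/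
def blockGrad (v : 𝔼 → 𝔼) (l : ℤ) : ℝ≥0∞ :=
  ∑ i, eLpNorm (fun x => fderiv ℝ (blockFn l v) x (stdOrthonormalBasis ℝ 𝔼 i)) 2 volume

/-- The dyadic `Ḣ¹` energy `F(v) = ∑_l 4^l ‖Δ̇_l v‖₂²`. [folklore] -/
def dyadicF (v : 𝔼 → 𝔼) : ℝ≥0∞ := dyadicSqSum (blockL2 v)

/-- The dyadic `Ḣ²` dissipation `D(v) = ∑_l 4^l (∑_i ‖∂_i Δ̇_l v‖₂)²`. [folklore] -/
def dyadicD (v : 𝔼 → 𝔼) : ℝ≥0∞ := dyadicSqSum (blockGrad v)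

namespace LPBounds

variable (K : LPBounds ι)

/-- The reverse Bernstein inequality in the form used by `ParaproductSums`: `2^l a_l ≤ C_r g_l`. [folklore] -/
theorem two_zpow_mul_blockL2_le {v : 𝔼 → 𝔼} (hv : IsSmoothL2Field v) (l : ℤ) :
    (2 : ℝ≥0∞) ^ l * blockL2 v l ≤ K.Cr * blockGrad v l := by
  have h := K.reverse l v hv
  have h2 : (2 : ℝ≥0∞) ^ (-(l : ℝ)) = ((2 : ℝ≥0∞) ^ l)⁻¹ := by
    rw [ENNReal.rpow_neg, ENNReal.rpow_intCast]
  rw [h2] at h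
  calc (2 : ℝ≥0∞) ^ l * blockL2 v l ≤ 2 ^ l * (K.Cr * (2 ^ l)⁻¹ * blockGrad v l) := mul_le_mul_right h _
    _ = K.Cr * blockGrad v l := by
        rw [← mul_assoc, ← mul_assoc, mul_comm ((2 : ℝ≥0∞) ^ l), mul_assoc (K.Cr : ℝ≥0∞),
          ENNReal.mul_inv_cancel (ENNReal.zpow_pos two_ne_zero ENNReal.ofNat_ne_top l).ne' (two_zpow_ne_top l), mul_one]

/-- `a_l ≤ C₂ ‖v‖₂`. [folklore] -/
theorem blockL2_le {v : 𝔼 → 𝔼} (hv : MemLp v 2 volume) (l : ℤ) : blockL2 v l ≤ K.C₂ * eLpNorm v 2 volume :=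
  K.two_le l v hv

/-- Bernstein for the block gradients: `g_l ≤ d C_b 2^l a_l`. [folklore] -/
theorem blockGrad_le {v : 𝔼 → 𝔼} (hv : IsSmoothL2Field v) (l : ℤ) :
    blockGrad v l ≤ Fintype.card ι * (K.Cb * ((2 : ℝ≥0∞) ^ l * blockL2 v l)) := by
  unfold blockGrad
  have h : ∀ i, eLpNorm (fun x => fderiv ℝ (blockFn l v) x (stdOrthonormalBasis ℝ 𝔼 i)) 2 volume ≤
      K.Cb * ((2 : ℝ≥0∞) ^ l * blockL2 v l) := by
    intro i
    refine (K.bernstein _ l v hv).trans_eq ?_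
    rw [(stdOrthonormalBasis ℝ 𝔼).orthonormal.1 i, mul_one, ofReal_two_zpow, mul_assoc]
    rfl
  calc ∑ i, eLpNorm (fun x => fderiv ℝ (blockFn l v) x (stdOrthonormalBasis ℝ 𝔼 i)) 2 volume
      ≤ ∑ _i : Fin (Module.finrank ℝ 𝔼), (K.Cb : ℝ≥0∞) * ((2 : ℝ≥0∞) ^ l * blockL2 v l) := Finset.sum_le_sum fun i _ => h i
    _ = Fintype.card ι * (K.Cb * ((2 : ℝ≥0∞) ^ l * blockL2 v l)) := by
        rw [Finset.sum_const, Finset.card_univ, Fintype.card_fin, finrank_euclideanSpace, nsmul_eq_mul]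

/-- The geometric factor `∑_n 2^{-n d/2}` of the low-frequency Bernstein sum. [folklore] -/
def geomDim (ι : Type*) [Fintype ι] : ℝ≥0∞ := ∑' n : ℕ, ((2 : ℝ≥0∞) ^ (-((Fintype.card ι : ℝ) * 2⁻¹))) ^ n

omit [Fintype ι] in
/-- The geometric factor is finite in positive dimension. [folklore] -/
theorem geomDim_lt_top {ι : Type*} [Fintype ι] [Nonempty ι] : geomDim ι < ∞ := by
  unfold geomDim
  rw [ENNReal.tsum_geometric, ENNReal.inv_lt_top, tsub_pos_iff_lt]
  have hd : (0 : ℝ) < (Fintype.card ι : ℝ) * 2⁻¹ := by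
    have : (0 : ℝ) < Fintype.card ι := by exact_mod_cast Fintype.card_pos
    positivity
  rw [ENNReal.rpow_neg, ENNReal.inv_lt_one]
  exact ENNReal.one_lt_rpow (by norm_num) hd

/-- **The low-frequency Bernstein sum**: `∑_{l<J} ‖Δ̇_l v‖_∞ ≤ C_∞ ‖v‖₂ 2^{(J-1)d/2} ∑_n 2^{-nd/2}`. [folklore] -/
theorem tsum_blockSup_low_le {v : 𝔼 → 𝔼} (hv : MemLp v 2 volume) (J : ℤ) :
    ∑' n : ℕ, blockSup v (J - 1 - n) ≤
      K.Cinf * eLpNorm v 2 volume * (2 : ℝ≥0∞) ^ (((J - 1 : ℤ) : ℝ) * Fintype.card ι * 2⁻¹) * geomDim ι := by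
  have hd : (Module.finrank ℝ 𝔼 : ℝ) = Fintype.card ι := by rw [finrank_euclideanSpace]
  have hterm : ∀ n : ℕ, blockSup v (J - 1 - n) ≤ K.Cinf * eLpNorm v 2 volume *
      ((2 : ℝ≥0∞) ^ (((J - 1 : ℤ) : ℝ) * Fintype.card ι * 2⁻¹) * ((2 : ℝ≥0∞) ^ (-((Fintype.card ι : ℝ) * 2⁻¹))) ^ n) := by
    intro n
    refine (K.sup_le (J - 1 - n) v hv).trans_eq ?_
    rw [hd, mul_right_comm, ← ENNReal.rpow_natCast, ← ENNReal.rpow_mul,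
      ← ENNReal.rpow_add _ _ two_ne_zero ENNReal.ofNat_ne_top]
    congr 2
    push_cast
    ring
  calc ∑' n : ℕ, blockSup v (J - 1 - n)
      ≤ ∑' n : ℕ, K.Cinf * eLpNorm v 2 volume *
          ((2 : ℝ≥0∞) ^ (((J - 1 : ℤ) : ℝ) * Fintype.card ι * 2⁻¹) * ((2 : ℝ≥0∞) ^ (-((Fintype.card ι : ℝ) * 2⁻¹))) ^ n) :=
        ENNReal.tsum_le_tsum hterm
    _ = _ := by
        rw [ENNReal.tsum_mul_left, ENNReal.tsum_mul_left, geomDim, ← mul_assoc]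

/-- The gradient `L²` energy `∑_i ‖∂_i v‖₂²`. [folklore] -/
def gradSq (v : 𝔼 → 𝔼) : ℝ≥0∞ := ∑ i, eLpNorm (fun x => fderiv ℝ v x (stdOrthonormalBasis ℝ 𝔼 i)) 2 volume ^ 2

/-- The derivative of a block is the block of the derivative, as an `L²` norm. [folklore] -/
theorem eLpNorm_fderiv_blockFn_eq {v : 𝔼 → 𝔼} (hv : IsSmoothL2Field v) (l : ℤ) (e : 𝔼) :
    eLpNorm (fun x => fderiv ℝ (blockFn l v) x e) 2 volume = eLpNorm (blockFn l (fun x => fderiv ℝ v x e)) 2 volume := by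
  rw [hv.toHasBoundedDerivs.fderiv_blockFn_apply l e]

/-- **`F ≤ 8 d C_r² ∑_i ‖∂_i v‖₂²`** (reverse Bernstein and the square-function upper bound applied to
the derivatives). [folklore] -/
theorem dyadicF_le_gradSq {v : 𝔼 → 𝔼} (hv : IsSmoothL2Field v) :
    dyadicF v ≤ 8 * (Fintype.card ι * ((K.Cr : ℝ≥0∞) ^ 2 * gradSq v)) := by
  have hd : Fintype.card (Fin (Module.finrank ℝ 𝔼)) = Fintype.card ι := by
    rw [Fintype.card_fin, finrank_euclideanSpace]
  unfold dyadicF dyadicSqSum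
  calc ∑' l, ((2 : ℝ≥0∞) ^ l * blockL2 v l) ^ 2
      ≤ ∑' l, (K.Cr : ℝ≥0∞) ^ 2 * (Fintype.card ι *
          ∑ i, eLpNorm (blockFn l (fun x => fderiv ℝ v x (stdOrthonormalBasis ℝ 𝔼 i))) 2 volume ^ 2) := by
        refine ENNReal.tsum_le_tsum fun l => ?_
        calc ((2 : ℝ≥0∞) ^ l * blockL2 v l) ^ 2 ≤ (K.Cr * blockGrad v l) ^ 2 :=
              ENNReal.pow_le_pow_left (K.two_zpow_mul_blockL2_le hv l)
          _ = (K.Cr : ℝ≥0∞) ^ 2 * blockGrad v l ^ 2 := by rw [mul_pow]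
          _ ≤ (K.Cr : ℝ≥0∞) ^ 2 * (Fintype.card ι *
              ∑ i, eLpNorm (blockFn l (fun x => fderiv ℝ v x (stdOrthonormalBasis ℝ 𝔼 i))) 2 volume ^ 2) := by
              gcongr
              unfold blockGrad
              simp_rw [eLpNorm_fderiv_blockFn_eq hv]
              have := ennreal_sq_sum_le_card_mul_sum_sq (Finset.univ : Finset (Fin (Module.finrank ℝ 𝔼)))
                (fun i => eLpNorm (blockFn l (fun x => fderiv ℝ v x (stdOrthonormalBasis ℝ 𝔼 i))) 2 volume)
              rwa [Finset.card_univ, hd] at this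
    _ = (K.Cr : ℝ≥0∞) ^ 2 * (Fintype.card ι *
          ∑ i, ∑' l, eLpNorm (blockFn l (fun x => fderiv ℝ v x (stdOrthonormalBasis ℝ 𝔼 i))) 2 volume ^ 2) := by
        rw [ENNReal.tsum_mul_left, ENNReal.tsum_mul_left, Summable.tsum_finsetSum (fun i _ => ENNReal.summable)]
    _ ≤ (K.Cr : ℝ≥0∞) ^ 2 * (Fintype.card ι *
          ∑ i, 8 * eLpNorm (fun x => fderiv ℝ v x (stdOrthonormalBasis ℝ 𝔼 i)) 2 volume ^ 2) := by
        gcongr with i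
        exact K.sq_le _ (hv.memLp_fderiv_apply _)
    _ = 8 * (Fintype.card ι * ((K.Cr : ℝ≥0∞) ^ 2 * gradSq v)) := by
        rw [gradSq, ← Finset.mul_sum]; ring

/-- **`∑_i ‖∂_i v‖₂² ≤ 2 C_b² d F`** (the square-function lower bound applied to the derivatives and
Bernstein). [folklore] -/
theorem gradSq_le_dyadicF {v : 𝔼 → 𝔼} (hv : IsSmoothL2Field v) :
    gradSq v ≤ 2 * ((K.Cb : ℝ≥0∞) ^ 2 * (Fintype.card ι * dyadicF v)) := by
  have hd : Fintype.card (Fin (Module.finrank ℝ 𝔼)) = Fintype.card ι := by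
    rw [Fintype.card_fin, finrank_euclideanSpace]
  unfold gradSq
  have hterm : ∀ i, eLpNorm (fun x => fderiv ℝ v x (stdOrthonormalBasis ℝ 𝔼 i)) 2 volume ^ 2 ≤
      2 * ((K.Cb : ℝ≥0∞) ^ 2 * dyadicF v) := by
    intro i
    refine (K.le_sq _ (hv.memLp_fderiv_apply _)).trans ?_
    unfold dyadicF dyadicSqSum
    rw [← ENNReal.tsum_mul_left (a := (K.Cb : ℝ≥0∞) ^ 2)]
    refine mul_le_mul_right (ENNReal.tsum_le_tsum fun l => ?_) 2
    rw [← eLpNorm_fderiv_blockFn_eq hv, ← mul_pow]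
    refine ENNReal.pow_le_pow_left ((K.bernstein _ l v hv).trans_eq ?_)
    rw [(stdOrthonormalBasis ℝ 𝔼).orthonormal.1 i, mul_one, ofReal_two_zpow, mul_assoc]
    rfl
  calc ∑ i, eLpNorm (fun x => fderiv ℝ v x (stdOrthonormalBasis ℝ 𝔼 i)) 2 volume ^ 2
      ≤ ∑ _i : Fin (Module.finrank ℝ 𝔼), 2 * ((K.Cb : ℝ≥0∞) ^ 2 * dyadicF v) := Finset.sum_le_sum fun i _ => hterm i
    _ = _ := by rw [Finset.sum_const, Finset.card_univ, hd, nsmul_eq_mul]; ring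

/-- The Hessian `L²` energy `∑_{i,k} ‖∂_k ∂_i v‖₂²`. [folklore] -/
def hessSq (v : 𝔼 → 𝔼) : ℝ≥0∞ :=
  ∑ i, ∑ k, eLpNorm (fun x => fderiv ℝ (fun y => fderiv ℝ v y (stdOrthonormalBasis ℝ 𝔼 i)) x
    (stdOrthonormalBasis ℝ 𝔼 k)) 2 volume ^ 2

/-- The third-derivative `L²` sum `∑_{i,k,m} ‖∂_m ∂_k ∂_i v‖₂`. [folklore] -/
def thirdSum (v : 𝔼 → 𝔼) : ℝ≥0∞ :=
  ∑ i, ∑ k, ∑ m, eLpNorm (fun x => fderiv ℝ (fun z => fderiv ℝ (fun y => fderiv ℝ v y (stdOrthonormalBasis ℝ 𝔼 i)) z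
    (stdOrthonormalBasis ℝ 𝔼 k)) x (stdOrthonormalBasis ℝ 𝔼 m)) 2 volume

/-- **The weighted block gradient through the Hessian blocks**: `2^l g_l ≤ C_r ∑_{i,k} ‖Δ̇_l ∂_k∂_i v‖₂`
(reverse Bernstein applied to the fields `∂_i v`). [folklore] -/
theorem two_zpow_mul_blockGrad_le {v : 𝔼 → 𝔼} (hv : IsSmoothL2Field v) (l : ℤ) :
    (2 : ℝ≥0∞) ^ l * blockGrad v l ≤ K.Cr * ∑ i, ∑ k,
      eLpNorm (blockFn l (fun x => fderiv ℝ (fun y => fderiv ℝ v y (stdOrthonormalBasis ℝ 𝔼 i)) x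
        (stdOrthonormalBasis ℝ 𝔼 k))) 2 volume := by
  set b := stdOrthonormalBasis ℝ 𝔼
  unfold blockGrad
  rw [Finset.mul_sum, Finset.mul_sum]
  refine Finset.sum_le_sum fun i _ => ?_
  have hvi : IsSmoothL2Field (fun y => fderiv ℝ v y (b i)) := hv.fderiv_apply (b i)
  have h1 := K.two_zpow_mul_blockL2_le hvi l
  rw [blockL2, ← eLpNorm_fderiv_blockFn_eq hv] at h1
  refine h1.trans ?_
  unfold blockGrad
  gcongr with k
  rw [eLpNorm_fderiv_blockFn_eq hvi]

/-- **`D ≤ 8 d² C_r² ∑_{i,k} ‖∂_k∂_i v‖₂²`**. [folklore] -/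
theorem dyadicD_le_hessSq {v : 𝔼 → 𝔼} (hv : IsSmoothL2Field v) :
    dyadicD v ≤ 8 * ((Fintype.card ι : ℝ≥0∞) ^ 2 * ((K.Cr : ℝ≥0∞) ^ 2 * hessSq v)) := by
  set b := stdOrthonormalBasis ℝ 𝔼
  have hd : Fintype.card (Fin (Module.finrank ℝ 𝔼)) = Fintype.card ι := by
    rw [Fintype.card_fin, finrank_euclideanSpace]
  set w : Fin (Module.finrank ℝ 𝔼) → Fin (Module.finrank ℝ 𝔼) → 𝔼 → 𝔼 :=
    fun i k x => fderiv ℝ (fun y => fderiv ℝ v y (b i)) x (b k) with hw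
  have hwS : ∀ i k, IsSmoothL2Field (w i k) := fun i k => (hv.fderiv_apply (b i)).fderiv_apply (b k)
  -- termwise
  have hterm : ∀ l, ((2 : ℝ≥0∞) ^ l * blockGrad v l) ^ 2 ≤
      (K.Cr : ℝ≥0∞) ^ 2 * ((Fintype.card ι : ℝ≥0∞) ^ 2 * ∑ i, ∑ k, eLpNorm (blockFn l (w i k)) 2 volume ^ 2) := by
    intro l
    calc ((2 : ℝ≥0∞) ^ l * blockGrad v l) ^ 2 ≤ (K.Cr * ∑ i, ∑ k, eLpNorm (blockFn l (w i k)) 2 volume) ^ 2 :=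
          ENNReal.pow_le_pow_left (K.two_zpow_mul_blockGrad_le hv l)
      _ = (K.Cr : ℝ≥0∞) ^ 2 * (∑ i, ∑ k, eLpNorm (blockFn l (w i k)) 2 volume) ^ 2 := by rw [mul_pow]
      _ ≤ (K.Cr : ℝ≥0∞) ^ 2 * ((Fintype.card ι : ℝ≥0∞) ^ 2 * ∑ i, ∑ k, eLpNorm (blockFn l (w i k)) 2 volume ^ 2) := by
          gcongr
          calc (∑ i, ∑ k, eLpNorm (blockFn l (w i k)) 2 volume) ^ 2
              ≤ Fintype.card ι * ∑ i, (∑ k, eLpNorm (blockFn l (w i k)) 2 volume) ^ 2 := by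
                have := ennreal_sq_sum_le_card_mul_sum_sq (Finset.univ : Finset (Fin (Module.finrank ℝ 𝔼)))
                  (fun i => ∑ k, eLpNorm (blockFn l (w i k)) 2 volume)
                rwa [Finset.card_univ, hd] at this
            _ ≤ Fintype.card ι * ∑ i, (Fintype.card ι * ∑ k, eLpNorm (blockFn l (w i k)) 2 volume ^ 2) := by
                gcongr with i
                have := ennreal_sq_sum_le_card_mul_sum_sq (Finset.univ : Finset (Fin (Module.finrank ℝ 𝔼)))
                  (fun k => eLpNorm (blockFn l (w i k)) 2 volume)
                rwa [Finset.card_univ, hd] at this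
            _ = (Fintype.card ι : ℝ≥0∞) ^ 2 * ∑ i, ∑ k, eLpNorm (blockFn l (w i k)) 2 volume ^ 2 := by
                rw [← Finset.mul_sum]; ring
  unfold dyadicD dyadicSqSum
  calc ∑' l, ((2 : ℝ≥0∞) ^ l * blockGrad v l) ^ 2
      ≤ ∑' l, (K.Cr : ℝ≥0∞) ^ 2 * ((Fintype.card ι : ℝ≥0∞) ^ 2 * ∑ i, ∑ k, eLpNorm (blockFn l (w i k)) 2 volume ^ 2) :=
        ENNReal.tsum_le_tsum hterm
    _ = (K.Cr : ℝ≥0∞) ^ 2 * ((Fintype.card ι : ℝ≥0∞) ^ 2 * ∑ i, ∑ k, ∑' l, eLpNorm (blockFn l (w i k)) 2 volume ^ 2) := by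
        rw [ENNReal.tsum_mul_left, ENNReal.tsum_mul_left, Summable.tsum_finsetSum (fun i _ => ENNReal.summable)]
        congr 2
        exact Finset.sum_congr rfl fun i _ => Summable.tsum_finsetSum (fun k _ => ENNReal.summable)
    _ ≤ (K.Cr : ℝ≥0∞) ^ 2 * ((Fintype.card ι : ℝ≥0∞) ^ 2 * ∑ i, ∑ k, 8 * eLpNorm (w i k) 2 volume ^ 2) := by
        gcongr with i _ k
        exact K.sq_le _ (hwS i k).memLp_two
    _ = 8 * ((Fintype.card ι : ℝ≥0∞) ^ 2 * ((K.Cr : ℝ≥0∞) ^ 2 * hessSq v)) := by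
        simp_rw [← Finset.mul_sum]
        rw [hessSq]; ring

/-- **High blocks of the weighted gradient decay**: `2^l g_l ≤ C_r² C₂ 2^{-l} T₃(v)` (reverse
Bernstein twice and the `L²` bound of the blocks on the third derivatives). [folklore] -/
theorem two_zpow_mul_blockGrad_le_third {v : 𝔼 → 𝔼} (hv : IsSmoothL2Field v) (l : ℤ) :
    (2 : ℝ≥0∞) ^ l * blockGrad v l ≤ (K.Cr : ℝ≥0∞) ^ 2 * K.C₂ * (2 ^ l)⁻¹ * thirdSum v := by
  set b := stdOrthonormalBasis ℝ 𝔼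
  have h2l : (2 : ℝ≥0∞) ^ l ≠ 0 := (ENNReal.zpow_pos two_ne_zero ENNReal.ofNat_ne_top l).ne'
  refine (K.two_zpow_mul_blockGrad_le hv l).trans ?_
  unfold thirdSum
  rw [Finset.mul_sum, Finset.mul_sum]
  refine Finset.sum_le_sum fun i _ => ?_
  rw [Finset.mul_sum, Finset.mul_sum]
  refine Finset.sum_le_sum fun k _ => ?_
  set w : 𝔼 → 𝔼 := fun x => fderiv ℝ (fun y => fderiv ℝ v y (b i)) x (b k) with hw
  have hwS : IsSmoothL2Field w := (hv.fderiv_apply (b i)).fderiv_apply (b k)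
  -- `‖Δ̇_l w‖₂ ≤ C_r 2^{-l} ∑_m ‖∂_m Δ̇_l w‖₂ ≤ C_r 2^{-l} C₂ ∑_m ‖∂_m w‖₂`
  have h1 : eLpNorm (blockFn l w) 2 volume ≤ K.Cr * (2 ^ l)⁻¹ * blockGrad w l := by
    have := K.two_zpow_mul_blockL2_le hwS l
    rw [blockL2] at this
    calc eLpNorm (blockFn l w) 2 volume = (2 ^ l)⁻¹ * (2 ^ l * eLpNorm (blockFn l w) 2 volume) := by
          rw [← mul_assoc, ENNReal.inv_mul_cancel h2l (two_zpow_ne_top l), one_mul]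
      _ ≤ (2 ^ l)⁻¹ * (K.Cr * blockGrad w l) := mul_le_mul_right this _
      _ = K.Cr * (2 ^ l)⁻¹ * blockGrad w l := by ring
  have h2 : blockGrad w l ≤ K.C₂ * ∑ m, eLpNorm (fun x => fderiv ℝ w x (b m)) 2 volume := by
    unfold blockGrad
    rw [Finset.mul_sum]
    refine Finset.sum_le_sum fun m _ => ?_
    rw [eLpNorm_fderiv_blockFn_eq hwS]
    exact K.two_le l _ (hwS.memLp_fderiv_apply (b m))
  calc (K.Cr : ℝ≥0∞) * eLpNorm (blockFn l w) 2 volume ≤ K.Cr * (K.Cr * (2 ^ l)⁻¹ * (K.C₂ * ∑ m, eLpNorm (fun x => fderiv ℝ w x (b m)) 2 volume)) := by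
        gcongr
        exact h1.trans (mul_le_mul_right h2 _)
    _ = (K.Cr : ℝ≥0∞) ^ 2 * K.C₂ * (2 ^ l)⁻¹ * ∑ m, eLpNorm (fun x => fderiv ℝ w x (b m)) 2 volume := by ring

/-- **Low blocks of the weighted gradient decay**: `2^l g_l ≤ d C_b C₂ 4^l ‖v‖₂` (Bernstein and the
`L²` bound of the blocks). [folklore] -/
theorem two_zpow_mul_blockGrad_le_low {v : 𝔼 → 𝔼} (hv : IsSmoothL2Field v) (l : ℤ) :
    (2 : ℝ≥0∞) ^ l * blockGrad v l ≤ Fintype.card ι * (K.Cb * (K.C₂ * ((2 : ℝ≥0∞) ^ (2 * l) * eLpNorm v 2 volume))) := by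
  have h2 : (2 : ℝ≥0∞) ≠ 0 := two_ne_zero
  have h2' : (2 : ℝ≥0∞) ≠ ∞ := ENNReal.ofNat_ne_top
  calc (2 : ℝ≥0∞) ^ l * blockGrad v l ≤ 2 ^ l * (Fintype.card ι * (K.Cb * ((2 : ℝ≥0∞) ^ l * blockL2 v l))) :=
        mul_le_mul_right (K.blockGrad_le hv l) _
    _ ≤ 2 ^ l * (Fintype.card ι * (K.Cb * ((2 : ℝ≥0∞) ^ l * (K.C₂ * eLpNorm v 2 volume)))) := by
        gcongr; exact K.blockL2_le hv.memLp_two l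
    _ = Fintype.card ι * (K.Cb * (K.C₂ * ((2 : ℝ≥0∞) ^ (2 * l) * eLpNorm v 2 volume))) := by
        rw [two_mul, ENNReal.zpow_add h2 h2']; ring

omit [Fintype ι] in
/-- A `ℤ`-indexed sum splits into a symmetric window and the two tails. [folklore] -/
theorem tsum_le_sum_Icc_add_tails (f : ℤ → ℝ≥0∞) (L : ℕ) :
    ∑' l, f l ≤ (∑ l ∈ Finset.Icc (-(L : ℤ)) L, f l) +
      ((∑' n : ℕ, f ((L : ℤ) + 1 + n)) + ∑' n : ℕ, f (-(L : ℤ) - 1 - n)) := by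
  classical
  have hsplit : ∀ l, f l ≤ (if l ∈ Finset.Icc (-(L : ℤ)) L then f l else 0) +
      ((if (L : ℤ) + 1 ≤ l then f l else 0) + (if l < -(L : ℤ) then f l else 0)) := by
    intro l
    by_cases h1 : l ∈ Finset.Icc (-(L : ℤ)) L
    · rw [if_pos h1]; exact le_self_add
    · rw [if_neg h1, zero_add]
      rw [Finset.mem_Icc, not_and_or, not_le, not_le] at h1
      rcases h1 with h1 | h1
      · rw [if_neg (by omega), if_pos h1, zero_add]
      · rw [if_pos (by omega), if_neg (by omega), add_zero]
  refine (ENNReal.tsum_le_tsum hsplit).trans ?_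
  rw [ENNReal.tsum_add, ENNReal.tsum_add]
  refine add_le_add (le_of_eq ?_) (add_le_add (le_of_eq ?_) (le_of_eq ?_))
  · rw [tsum_eq_sum (s := Finset.Icc (-(L : ℤ)) L) fun l hl => if_neg hl]
    exact Finset.sum_congr rfl fun l hl => if_pos hl
  · rw [tsum_ite_ge_eq]
  · rw [tsum_ite_lt_eq]

omit [Fintype ι] in
/-- `∑_n 4^{-(L+1+n)} ≤ 4^{-L}` (compare with `4^{-L} ∑_n 2^{-(n+1)} = 4^{-L}`). [folklore] -/
theorem tsum_four_inv_pow_succ_le (L : ℕ) : ∑' n : ℕ, (4⁻¹ : ℝ≥0∞) ^ (L + 1 + n) ≤ (4⁻¹ : ℝ≥0∞) ^ L := by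
  have h4 : (4⁻¹ : ℝ≥0∞) ≤ 2⁻¹ := ENNReal.inv_le_inv.2 (by norm_num)
  have h : ∀ n : ℕ, (4⁻¹ : ℝ≥0∞) ^ (L + 1 + n) ≤ (4⁻¹ : ℝ≥0∞) ^ L * (2⁻¹ * (2⁻¹) ^ n) := by
    intro n
    rw [add_assoc, pow_add, ← pow_succ', add_comm 1 n]
    exact mul_le_mul_right (pow_le_pow_left' h4 (n + 1)) _
  refine (ENNReal.tsum_le_tsum h).trans ?_
  rw [ENNReal.tsum_mul_left, ENNReal.tsum_mul_left, ENNReal.tsum_geometric_two,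
    ENNReal.inv_mul_cancel two_ne_zero ENNReal.ofNat_ne_top, mul_one]

omit [Fintype ι] in
/-- `((2⁻¹)^k)² = (4⁻¹)^k`. [folklore] -/
theorem two_inv_pow_sq (k : ℕ) : ((2⁻¹ : ℝ≥0∞) ^ k) ^ 2 = (4⁻¹ : ℝ≥0∞) ^ k := by
  rw [← pow_mul, mul_comm, pow_mul]
  congr 1
  rw [← ENNReal.inv_pow]
  norm_num

omit [Fintype ι] in
/-- `(2^m)⁻¹ = (2⁻¹)^m` and `2^{2·(-m)} = (4⁻¹)^m` bookkeeping. [folklore] -/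
theorem two_zpow_two_mul_neg_natCast (m : ℕ) : (2 : ℝ≥0∞) ^ (2 * (-(m : ℤ))) = (4⁻¹ : ℝ≥0∞) ^ m := by
  rw [show (2 : ℤ) * (-(m : ℤ)) = -((2 * m : ℕ) : ℤ) by push_cast; ring, ENNReal.zpow_neg, zpow_natCast, pow_mul,
    ENNReal.inv_pow]
  norm_num

/-- **Tail bound for the dyadic dissipation**: with `D_L = ∑_{|l| ≤ L} (2^l g_l)²`,
`D ≤ D_L + 4^{-L} ((C_r² C₂ T₃)² + (d C_b C₂ ‖v‖₂)²)` — uniformly small tails on a slab where the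
third derivatives and the energy are bounded. [folklore] -/
theorem dyadicD_le_sum_Icc_add {v : 𝔼 → 𝔼} (hv : IsSmoothL2Field v) (L : ℕ) :
    dyadicD v ≤ (∑ l ∈ Finset.Icc (-(L : ℤ)) L, ((2 : ℝ≥0∞) ^ l * blockGrad v l) ^ 2) +
      (4⁻¹ : ℝ≥0∞) ^ L *
        (((K.Cr : ℝ≥0∞) ^ 2 * K.C₂ * thirdSum v) ^ 2 +
          (Fintype.card ι * (K.Cb * (K.C₂ * eLpNorm v 2 volume))) ^ 2) := by
  unfold dyadicD dyadicSqSum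
  refine (tsum_le_sum_Icc_add_tails _ L).trans ?_
  gcongr
  rw [mul_add]
  refine add_le_add ?_ ?_
  · -- high tail: `(2^l g_l)² ≤ (4⁻¹)^{L+1+n} (C_r² C₂ T₃)²` at `l = L+1+n`
    have hterm : ∀ n : ℕ, ((2 : ℝ≥0∞) ^ ((L : ℤ) + 1 + n) * blockGrad v ((L : ℤ) + 1 + n)) ^ 2 ≤
        (4⁻¹ : ℝ≥0∞) ^ (L + 1 + n) * ((K.Cr : ℝ≥0∞) ^ 2 * K.C₂ * thirdSum v) ^ 2 := by
      intro n
      refine (ENNReal.pow_le_pow_left (K.two_zpow_mul_blockGrad_le_third hv _)).trans ?_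
      have hinv : ((2 : ℝ≥0∞) ^ ((L : ℤ) + 1 + n))⁻¹ = (2⁻¹ : ℝ≥0∞) ^ (L + 1 + n) := by
        rw [show (L : ℤ) + 1 + n = ((L + 1 + n : ℕ) : ℤ) by push_cast; ring, zpow_natCast, ENNReal.inv_pow]
      rw [hinv, show (K.Cr : ℝ≥0∞) ^ 2 * K.C₂ * (2⁻¹ : ℝ≥0∞) ^ (L + 1 + n) * thirdSum v =
        (2⁻¹ : ℝ≥0∞) ^ (L + 1 + n) * ((K.Cr : ℝ≥0∞) ^ 2 * K.C₂ * thirdSum v) by ring, mul_pow, two_inv_pow_sq]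
    refine (ENNReal.tsum_le_tsum hterm).trans ?_
    rw [ENNReal.tsum_mul_right]
    gcongr
    exact tsum_four_inv_pow_succ_le L
  · -- low tail: `(2^l g_l)² ≤ (4⁻¹)^{L+1+n} (d C_b C₂ ‖v‖₂)²` at `l = -L-1-n`
    have hterm : ∀ n : ℕ, ((2 : ℝ≥0∞) ^ (-(L : ℤ) - 1 - n) * blockGrad v (-(L : ℤ) - 1 - n)) ^ 2 ≤
        (4⁻¹ : ℝ≥0∞) ^ (L + 1 + n) * (Fintype.card ι * (K.Cb * (K.C₂ * eLpNorm v 2 volume))) ^ 2 := by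
      intro n
      refine (ENNReal.pow_le_pow_left (K.two_zpow_mul_blockGrad_le_low hv _)).trans ?_
      have h4 : (2 : ℝ≥0∞) ^ (2 * (-(L : ℤ) - 1 - n)) = (4⁻¹ : ℝ≥0∞) ^ (L + 1 + n) := by
        rw [show (2 : ℤ) * (-(L : ℤ) - 1 - n) = 2 * (-((L + 1 + n : ℕ) : ℤ)) by push_cast; ring]
        exact two_zpow_two_mul_neg_natCast _
      rw [h4, show (Fintype.card ι : ℝ≥0∞) * (K.Cb * (K.C₂ * ((4⁻¹ : ℝ≥0∞) ^ (L + 1 + n) * eLpNorm v 2 volume))) =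
        (4⁻¹ : ℝ≥0∞) ^ (L + 1 + n) * (Fintype.card ι * (K.Cb * (K.C₂ * eLpNorm v 2 volume))) by ring, mul_pow]
      refine mul_le_mul_left ?_ _
      -- `x² ≤ x` for `x = (4⁻¹)^k ≤ 1`
      have hx : (4⁻¹ : ℝ≥0∞) ^ (L + 1 + n) ≤ 1 := pow_le_one₀ bot_le (ENNReal.inv_le_one.2 (by norm_num))
      calc ((4⁻¹ : ℝ≥0∞) ^ (L + 1 + n)) ^ 2 = (4⁻¹ : ℝ≥0∞) ^ (L + 1 + n) * (4⁻¹ : ℝ≥0∞) ^ (L + 1 + n) := sq _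
        _ ≤ (4⁻¹ : ℝ≥0∞) ^ (L + 1 + n) * 1 := mul_le_mul_right hx _
        _ = _ := mul_one _
    refine (ENNReal.tsum_le_tsum hterm).trans ?_
    rw [ENNReal.tsum_mul_right]
    gcongr
    exact tsum_four_inv_pow_succ_le L

end LPBounds

end Literature.Analysis.FluidPDE

end
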